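import Summits.NavierStokesRegularity.NavierStokesRegularity.Theorems.AxisymmetricExtremalityAxisymmetricKatoGlobalStubSeregin2020TypeIILemma22EnergyClassOfClassV
import Summits.NavierStokesRegularity.NavierStokesRegularity.Theorems.AxisymmetricExtremalityAxisymmetricKatoGlobalStubSeregin2020TypeIILemma22ErrorPackage
import HarnessLib

/-!
# L22-B (Seregin 2020 Lemma 2.2 ⇐ N–U 2012 Lemma 4.2 for the class `𝒱`): the energy class of the
# normalised class-`𝒱` pair across the axis and `S` — the `hEC` contract

`energyClass_acrossAxis_of_classV` is the L22-B input of the cell's `hWH′` assembly in EXACTLY the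
contract shape of kits/A1-assembly-hEC.md (sha16 4a7d05a5ae60bc8d): for the raw class-`𝒱` data
`(U, Φ, S)` (binders of `stub_L22C_cor33`), `0 < R`, `0 < k`, the drift bound, the axis lower bound and
the normalised pair `(Φ', U')` given by four pointwise clauses, the registered v3 `EnergyClass Φ' U' k R`
text holds.  Proof: `energyClass_acrossAxis_of_classV_of_excisionErrors` (route P: closed time pieces of
the excision schedule, F2′-real per piece, telescoping, `ε → 0` by dominated convergence / Fatou, then
`σ → 0⁺`) with its excision-error package discharged by `excisionError_package` ((e1) es-p1,
(e2)(e3) ser-c).  [cite: NazarovUraltseva2012, §3 (3.9), Remark 9, Lemma 4.2; Seregin2020, Lemma 2.2]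

Proving this input makes the conditional `hWH′` assembly unconditional AS TYPED; no Navier–Stokes
regularity statement is proved here.
-/

noncomputable section

set_option linter.dupNamespace false

open MeasureTheory Set Function Filter Topology TopologicalSpace Metric
open scoped NNReal ENNReal InnerProductSpace RealInnerProductSpace

namespace Summit.NavierStokesRegularity.NavierStokesRegularity.Theorems.AxisymmetricKatoGlobal.EulerScaling

open Literature.Analysis.FluidPDE Literature.Analysis.FluidPDE.Seregin2020

/-- **L22-B: the energy class (N–U (3.9) with Remark 9) of the normalised class-`𝒱` pair, across the
symmetry axis and the `𝒫¹`-null closed singular set `S`** — the `hEC` hypothesis of the `hWH′`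
assembly, verbatim. [cite: NazarovUraltseva2012, §3 (3.9), Remark 9; Seregin2020, Lemma 2.2] -/
theorem energyClass_acrossAxis_of_classV :
    ∀ (U U' : ℝ → EuclideanSpace ℝ (Fin 3) → EuclideanSpace ℝ (Fin 3)) (Φ Φ' : ℝ → EuclideanSpace ℝ (Fin 3) → ℝ)
    (S : Set (ℝ × EuclideanSpace ℝ (Fin 3))) (R k : ℝ) (N : ℝ≥0),
    ContinuousOn (uncurry U) {z : ℝ × EuclideanSpace ℝ (Fin 3) | z.1 < 0 ∧ cylRadius z.2 ≠ 0} →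
    (∀ z : ℝ × EuclideanSpace ℝ (Fin 3), z.1 < 0 → cylRadius z.2 ≠ 0 → ContDiffAt ℝ (⊤ : ℕ∞) (U z.1) z.2) →
    ContinuousOn (fun z : ℝ × EuclideanSpace ℝ (Fin 3) => fderiv ℝ (U z.1) z.2) {z : ℝ × EuclideanSpace ℝ (Fin 3) | z.1 < 0 ∧ cylRadius z.2 ≠ 0} →
    (∀ z : ℝ × EuclideanSpace ℝ (Fin 3), z.1 < 0 → cylRadius z.2 ≠ 0 → VectorCalculus.divergence (U z.1) z.2 = 0) →
    (∀ a : ℝ, 0 < a → ∫⁻ z in parabolicCylinder a (0 : ℝ × EuclideanSpace ℝ (Fin 3)), ‖U z.1 z.2‖ₑ ^ (3 : ℕ) < ∞) →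
    IsClosed S → (∀ z ∈ S, z.1 ≤ 0 ∧ cylRadius z.2 = 0) → IsParabolicNull 1 S →
    ContinuousOn (uncurry Φ) ({z : ℝ × EuclideanSpace ℝ (Fin 3) | z.1 < 0} \ S) →
    (∀ z : ℝ × EuclideanSpace ℝ (Fin 3), z.1 < 0 → z ∉ S → ContDiffAt ℝ (⊤ : ℕ∞) (Φ z.1) z.2) →
    ContinuousOn (fun z : ℝ × EuclideanSpace ℝ (Fin 3) => fderiv ℝ (Φ z.1) z.2) ({z : ℝ × EuclideanSpace ℝ (Fin 3) | z.1 < 0} \ S) →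
    (∀ e : EuclideanSpace ℝ (Fin 3), ContinuousOn (fun z : ℝ × EuclideanSpace ℝ (Fin 3) => fderiv ℝ (fun y => fderiv ℝ (Φ z.1) y e) z.2 e)
    ({z : ℝ × EuclideanSpace ℝ (Fin 3) | z.1 < 0} \ S)) →
    (∀ z : ℝ × EuclideanSpace ℝ (Fin 3), z.1 < 0 → cylRadius z.2 ≠ 0 → DifferentiableAt ℝ (fun r => Φ r z.2) z.1) →
    ContinuousOn (fun z : ℝ × EuclideanSpace ℝ (Fin 3) => deriv (fun r => Φ r z.2) z.1)
    {z : ℝ × EuclideanSpace ℝ (Fin 3) | z.1 < 0 ∧ cylRadius z.2 ≠ 0} →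
    (∀ δ' ρ : ℝ, 0 < δ' → δ' < ρ → ∃ C : ℝ, ∀ z : ℝ × EuclideanSpace ℝ (Fin 3),
    z.1 ∈ Ioo (-ρ ^ 2) 0 → δ' < cylRadius z.2 → cylRadius z.2 < ρ → |z.2 2| < ρ →
    |deriv (fun r => Φ r z.2) z.1| ≤ C ∧ ‖fderiv ℝ (Φ z.1) z.2‖ ≤ C ∧
    ∀ e : EuclideanSpace ℝ (Fin 3), ‖e‖ ≤ 1 → |fderiv ℝ (fun y => fderiv ℝ (Φ z.1) y e) z.2 e| ≤ C) →
    (∃ B : ℝ, ∀ z : ℝ × EuclideanSpace ℝ (Fin 3), z.1 < 0 → z ∉ S → |Φ z.1 z.2| ≤ B) →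
    (∀ z : ℝ × EuclideanSpace ℝ (Fin 3), z.1 < 0 → z ∉ S → 0 ≤ Φ z.1 z.2) →
    (∀ z : ℝ × EuclideanSpace ℝ (Fin 3), z.1 < 0 → cylRadius z.2 ≠ 0 →
    0 ≤ deriv (fun r => Φ r z.2) z.1 + fderiv ℝ (Φ z.1) z.2 (U z.1 z.2) +
    2 / cylRadius z.2 * partialDeriv (eR z.2) (Φ z.1) z.2 - (Laplacian.laplacian (Φ z.1)) z.2) →
    0 < R → 0 < k →
    (∫⁻ s in Ioo (-R ^ 2) 0, (∫⁻ y in ball (0 : EuclideanSpace ℝ (Fin 3)) (2 * R), ‖U s y‖ₑ ^ (3 : ℕ)) ^ (4 / 3 : ℝ) ≤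
    (N : ℝ≥0∞) * ENNReal.ofReal R ^ 2) →
    (∀ z : ℝ × EuclideanSpace ℝ (Fin 3), z.1 ∈ Ioo (-R ^ 2) 0 → cylRadius z.2 = 0 →
    z.2 2 ∈ Ioo (-(2 * R)) (2 * R) → z ∉ S → k ≤ Φ z.1 z.2) →
    (∀ t x, t < 0 → (t, x) ∉ S → Φ' t x = Φ t x) → (∀ t x, ¬ (t < 0 ∧ (t, x) ∉ S) → Φ' t x = k) →
    (∀ t x, t < 0 → cylRadius x ≠ 0 → U' t x = U t x) → (∀ t x, ¬ (t < 0 ∧ cylRadius x ≠ 0) → U' t x = 0) →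
    (∀ (H : ℝ → ℝ), ContDiff ℝ 2 H → (∀ v, deriv H v ≤ 0) → (∀ v, 0 ≤ H v) → (∀ v, 0 ≤ deriv
    (deriv H) v) → (∀ v, deriv H v ^ 2 ≤ 2 * H v * deriv (deriv H) v) → (∀ v, k ≤ v → H v = 0)
    → ∀ (Θ : EuclideanSpace ℝ (Fin 3) → ℝ), ContDiff ℝ 1 Θ → HasCompactSupport Θ → tsupport Θ
    ⊆ ball (0 : EuclideanSpace ℝ (Fin 3)) (2 * R) → ∀ (η : ℝ → ℝ), ContDiff ℝ 1 η → (∀ s, 0 ≤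
    η s) → ∀ (t₁ t₂ : ℝ), -R ^ 2 < t₁ → t₁ ≤ t₂ → t₂ < 0 → ENNReal.ofReal (η t₂ * ∫ x, H (Φ' t₂
    x) * Θ x ^ 2) + ∫⁻ z in Icc t₁ t₂ ×ˢ (univ : Set (EuclideanSpace ℝ (Fin 3))),
    ENNReal.ofReal (1 / 2 * η z.1 * (deriv (deriv H) (Φ' z.1 z.2) * ‖gradient (Φ' z.1) z.2‖ ^ 2
    * Θ z.2 ^ 2)) ≤ ENNReal.ofReal (η t₁ * (∫ x, H (Φ' t₁ x) * Θ x ^ 2) + (4 * ∫ z in Icc t₁ t₂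
    ×ˢ (univ : Set (EuclideanSpace ℝ (Fin 3))), η z.1 * (H (Φ' z.1 z.2) * ‖gradient Θ z.2‖ ^
    2)) + (∫ z in Icc t₁ t₂ ×ˢ (univ : Set (EuclideanSpace ℝ (Fin 3))), η z.1 * (H (Φ' z.1 z.2)
    * inner ℝ (U' z.1 z.2) (gradient (fun y => Θ y ^ 2) z.2))) + (∫ z in Icc t₁ t₂ ×ˢ (univ :
    Set (EuclideanSpace ℝ (Fin 3))), η z.1 * (2 / cylRadius z.2 * (H (Φ' z.1 z.2) * fderiv ℝ
    (fun y => Θ y ^ 2) z.2 (eR z.2)))) + (∫ z in Icc t₁ t₂ ×ˢ (univ : Set (EuclideanSpace ℝ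
    (Fin 3))), |deriv η z.1| * (H (Φ' z.1 z.2) * Θ z.2 ^ 2)))) := by
  intro U U' Φ Φ' S R k N hUc hUs _hUg hdivU hU3 hSc hSax hSP hΦc hΦs hΦg _hΦ2 hΦt hΦt' _hbd _hB hΦ0 hsup hR hk0 _hN hk
    hΦ'1 hΦ'2 hU'1 hU'2
  exact energyClass_acrossAxis_of_classV_of_excisionErrors hUc hUs hdivU hU3 hSc hSax hSP hΦc hΦs hΦg hΦt hΦt' hΦ0
    hsup hR hk0 hk hΦ'1 hΦ'2 hU'1 hU'2 (excisionError_package hUc hU3 hSc hΦc hΦ0 hR hk0 hΦ'1 hΦ'2 hU'1 hU'2)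

end Summit.NavierStokesRegularity.NavierStokesRegularity.Theorems.AxisymmetricKatoGlobal.EulerScaling

end
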